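import Mathlib
import HarnessLib
import Summits.ResolutionOfSingularities.ResolutionOfSingularities.Theorems.WildQuotientsWildQuotientResolutionS1aSymChartModel
import Summits.ResolutionOfSingularities.ResolutionOfSingularities.Theorems.WildQuotientsWildQuotientResolutionS1aSymSections

/-!
# S1a — THE SYMMETRIC ROOT WITH A GENERAL TAIL `σx₃ = x₃ + t`, `e⁻¹t ∈ 𝒥_δ` (quasi-homogeneous tails, line arrangements not through `x₁`)

[OURS · L1 W4.5c · lead-1 g15; R3 (RULING R-F15l `lines_killsIn_two`: the tail `∏ ℓᵢ(x₁,x₂)` of the line-arrangement class is NOT divisible by `x₁` in general;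
ADVISORY R-F15m quasi-homogeneous tails `f(x₁,x₂)`); generalises the `x₁·r`-tail rows of ✓`…S1aSymRoot` / ✓`…S1aSymChartModel` / ✓`…S1aSymSections` — every other
lemma of those files is tail-independent and is reused verbatim] — NOT statements of the manuscript; counted 0; AI-level work, weaker than expert review. Crux
stmt-ResolutionOfSingularities-17941 `CyclicQuotientFourfolds`, line `s1a-logminvertex` v13 (`stub_reachLowerInFX`).

Datum: `σ` fixes constants and `x₀`, `σx₁ = x₁ + x₀`, `σx₂ = x₂ + x₀`, `σx₃ = x₃ + t` with `e⁻¹t ∈ 𝒥_δ((x₀,x₁,x₂); (δ+1,1,1))`; centre `e⁻¹(x₀, x₁, x₂)`, weights `(δ+1,1,1)`;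
the tail element `t̂ = e⁻¹t · T^δ ∈ R^w`.
* ring: `symT_admissible` / `symT_admissible_one` ((a′)_δ), `symT_map_le` (degree by degree), `symT_augmentationIdeal_sigmaR_le` ((H1) `aug σ_R ≤ (s^δ)`), `symT_sigmaR_algebraMap_three_sub`
  (`σ_R x₃ − x₃ = s^δ · t̂`), ★ `symT_tail_mem_residual` (`t̂ ∈ 𝔞 = (aug σ_R : s^δ)`: on the norm charts the residual is `V(u₀′) ∩ V(t̂)`);
* model: `symT_sigmaP_X_some_three` (`σ_P x₃ = x₃ + x_none^δ · Ψ t̂`), `symT_model_tail_pin` (`x_none^δ · Ψ t̂ = subst t`), `symT_model_row_three` (`τ′x₃ = x₃ + s^δ·T′` for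
  `subst t = x_none^δ·T′`), `symT_model_degree_tail` (`Ψ t̂ : δ•θ`);
* sections: `symT_tail_pow_mem_reesPiece`, ★ `symT_residualSection_one` (`t̂^{(δ+1)dp}/c`: degree 0, in `𝔞·R_c`).
-/

set_option linter.dupNamespace false

noncomputable section

open Literature.AlgebraicGeometry.Resolution
open scoped LaurentPolynomial
open MvPolynomial
open Summit.ResolutionOfSingularities.ResolutionOfSingularities.Theorems.WildQuotientResolution.S1
open Summit.ResolutionOfSingularities.ResolutionOfSingularities.Theorems.WildQuotientResolution.S1.CoarseChart
open Summit.ResolutionOfSingularities.ResolutionOfSingularities.Theorems.WildQuotientResolution.S1.ProducerStep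
open Summit.ResolutionOfSingularities.ResolutionOfSingularities.Theorems.WildQuotientResolution.S1.ReesBigrading
open Summit.ResolutionOfSingularities.ResolutionOfSingularities.Theorems.WildQuotientResolution.S1.NodeTransport
open Summit.ResolutionOfSingularities.ResolutionOfSingularities.Theorems.WildQuotientResolution.S1.CobordantTransport
open Summit.ResolutionOfSingularities.ResolutionOfSingularities.Theorems.WildQuotientResolution.S1.BlowupCharts

namespace Summit.ResolutionOfSingularities.ResolutionOfSingularities.Theorems.WildQuotientResolution.S1.KillCert.Sym

variable {k : Type} [Field k] {A : Type} [CommRing A]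
  (σ : MvPolynomial (Fin 4) k ≃+* MvPolynomial (Fin 4) k) (hC : ∀ a : k, σ (C a) = C a)
  (h0 : σ (X 0) = X 0) (h1 : σ (X 1) = X 1 + X 0) (h2 : σ (X 2) = X 2 + X 0) (δ : ℕ) (t : MvPolynomial (Fin 4) k)
  (h3 : σ (X 3) = X 3 + t)
  (e : A ≃+* MvPolynomial (Fin 4) k) (τ : A ≃+* A) (hact : ∀ x : A, τ x = e.symm (σ (e x)))
  (ht : e.symm t ∈ (weightedFiltration (e.symm ∘ ![X 0, X 1, X 2] : Fin 3 → A) ![δ + 1, 1, 1]).ideal δ)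

/-! ## Ring level -/

include hC h0 h1 h2 h3 hact ht in
/-- **(a′)_δ for the symmetric root with a general tail**: `y ∈ 𝒥ₙ ⇒ τy − y ∈ 𝒥ₙ₊δ`. [OURS · L1 W4.5c · symmetric root, general tail] -/
theorem symT_admissible (n : ℕ) (y : A) (hy : y ∈ (weightedFiltration (e.symm ∘ ![X 0, X 1, X 2] : Fin 3 → A) ![δ + 1, 1, 1]).ideal n) :
    τ y - y ∈ (weightedFiltration (e.symm ∘ ![X 0, X 1, X 2] : Fin 3 → A) ![δ + 1, 1, 1]).ideal (n + δ) := by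
  suffices h : τ y - y ∈ Ideal.span {(1 : A)} * (weightedFiltration (e.symm ∘ ![X 0, X 1, X 2] : Fin 3 → A) ![δ + 1, 1, 1]).ideal (n + δ) by
    rwa [Ideal.span_singleton_one, Ideal.top_mul] at h
  have hX0 : e.symm (X 0) ∈ (weightedFiltration (e.symm ∘ ![X 0, X 1, X 2] : Fin 3 → A) ![δ + 1, 1, 1]).ideal (δ + 1) :=
    mem_weightedFiltration_ideal (e.symm ∘ ![X 0, X 1, X 2] : Fin 3 → A) ![δ + 1, 1, 1] 0
  have h1J : ∀ {m : ℕ} {z : A}, z ∈ (weightedFiltration (e.symm ∘ ![X 0, X 1, X 2] : Fin 3 → A) ![δ + 1, 1, 1]).ideal m →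
      z ∈ Ideal.span {(1 : A)} * (weightedFiltration (e.symm ∘ ![X 0, X 1, X 2] : Fin 3 → A) ![δ + 1, 1, 1]).ideal m :=
    fun hz => by rw [Ideal.span_singleton_one, Ideal.top_mul]; exact hz
  have hgen : Subring.closure (e.symm '' (Set.range (C : k → MvPolynomial (Fin 4) k) ∪ Set.range (X : Fin 4 → MvPolynomial (Fin 4) k))) = ⊤ := by
    show Subring.closure ((e.symm : MvPolynomial (Fin 4) k →+* A) '' _) = ⊤
    rw [← RingHom.map_closure, closure_range_C_union_range_X_of k (Fin 4), ← RingHom.range_eq_map]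
    exact RingHom.range_eq_top.mpr e.symm.surjective
  refine admissible_shift_of_generators (e.symm ∘ ![X 0, X 1, X 2] : Fin 3 → A) ![δ + 1, 1, 1] τ δ 1 _ hgen ?_ ?_ n y hy
  · rintro _ ⟨g, hg | hg, rfl⟩
    · obtain ⟨a, rfl⟩ := hg
      rw [A1.act_symm σ e τ hact, hC, sub_self]; exact Ideal.zero_mem _
    · obtain ⟨i, rfl⟩ := hg
      refine h1J ?_
      fin_cases i
      · rw [Fin.zero_eta, A1.act_symm σ e τ hact, h0, sub_self]; exact Ideal.zero_mem _
      · rw [Fin.mk_one, A1.act_symm σ e τ hact, h1, map_add, add_sub_cancel_left]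
        exact (weightedFiltration _ _).antitone (by omega) hX0
      · change τ (e.symm (X 2)) - e.symm (X 2) ∈ _
        rw [A1.act_symm σ e τ hact, h2, map_add, add_sub_cancel_left]
        exact (weightedFiltration _ _).antitone (by omega) hX0
      · change τ (e.symm (X 3)) - e.symm (X 3) ∈ _
        rw [A1.act_symm σ e τ hact, h3, map_add, add_sub_cancel_left]
        exact ht
  · intro i
    refine h1J ?_
    fin_cases i
    · change τ (e.symm (X 0)) - e.symm (X 0) ∈ _
      rw [A1.act_symm σ e τ hact, h0, sub_self]; exact Ideal.zero_mem _
    · change τ (e.symm (X 1)) - e.symm (X 1) ∈ (weightedFiltration (e.symm ∘ ![X 0, X 1, X 2] : Fin 3 → A) ![δ + 1, 1, 1]).ideal (1 + δ)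
      rw [A1.act_symm σ e τ hact, h1, map_add, add_sub_cancel_left, Nat.add_comm 1 δ]; exact hX0
    · change τ (e.symm (X 2)) - e.symm (X 2) ∈ (weightedFiltration (e.symm ∘ ![X 0, X 1, X 2] : Fin 3 → A) ![δ + 1, 1, 1]).ideal (1 + δ)
      rw [A1.act_symm σ e τ hact, h2, map_add, add_sub_cancel_left, Nat.add_comm 1 δ]; exact hX0

include hC h0 h1 h2 h3 hact ht in
/-- (a′)_δ in the `β = 1` product form used by the kill-shift lemmas. -/
theorem symT_admissible_one (n : ℕ) (y : A) (hy : y ∈ (weightedFiltration (e.symm ∘ ![X 0, X 1, X 2] : Fin 3 → A) ![δ + 1, 1, 1]).ideal n) :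
    τ y - y ∈ Ideal.span {(1 : A)} * (weightedFiltration (e.symm ∘ ![X 0, X 1, X 2] : Fin 3 → A) ![δ + 1, 1, 1]).ideal (n + δ) := by
  rw [Ideal.span_singleton_one, Ideal.top_mul]; exact symT_admissible σ hC h0 h1 h2 δ t h3 e τ hact ht n y hy

include hC h0 h1 h2 h3 hact ht in
/-- σ-adaptedness of the symmetric centre (general tail), degree by degree. -/
theorem symT_map_le (n : ℕ) : ((weightedFiltration (e.symm ∘ ![X 0, X 1, X 2] : Fin 3 → A) ![δ + 1, 1, 1]).ideal n).map (τ : A →+* A) ≤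
    (weightedFiltration (e.symm ∘ ![X 0, X 1, X 2] : Fin 3 → A) ![δ + 1, 1, 1]).ideal n :=
  map_le_of_admissible_shift _ _ τ δ 1 (symT_admissible_one σ hC h0 h1 h2 δ t h3 e τ hact ht) n

section Residual

variable {p : ℕ} (hp : 0 < p) (hσp : ∀ x : A, (⇑τ)^[p] x = x)
  (hσJ : ∀ n : ℕ, ((weightedFiltration (e.symm ∘ ![X 0, X 1, X 2] : Fin 3 → A) ![δ + 1, 1, 1]).ideal n).map (τ : A →+* A) ≤
    (weightedFiltration (e.symm ∘ ![X 0, X 1, X 2] : Fin 3 → A) ![δ + 1, 1, 1]).ideal n)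

include hC h0 h1 h2 h3 hact ht in
/-- **(H1)** (general tail): every increment `σ_R z − z` is a multiple of `s^δ`. -/
theorem symT_augmentationIdeal_sigmaR_le :
    augmentationIdeal (sigmaR τ (e.symm ∘ ![X 0, X 1, X 2] : Fin 3 → A) ![δ + 1, 1, 1] hσJ hp hσp) ≤
      Ideal.span {cobordantAlgebra.s (e.symm ∘ ![X 0, X 1, X 2] : Fin 3 → A) ![δ + 1, 1, 1] ^ δ} := by
  have h := augmentationIdeal_sigmaR_le_span_of_admissible_shift (e.symm ∘ ![X 0, X 1, X 2] : Fin 3 → A) ![δ + 1, 1, 1] τ hσJ hp hσp δ 1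
    (symT_admissible_one σ hC h0 h1 h2 δ t h3 e τ hact ht)
  rwa [map_one, one_mul] at h

include h3 hact in
/-- `σ_R x₃ − x₃ = s^δ · t̂`, `t̂ = e⁻¹t·T^δ`. -/
theorem symT_sigmaR_algebraMap_three_sub :
    sigmaR τ (e.symm ∘ ![X 0, X 1, X 2] : Fin 3 → A) ![δ + 1, 1, 1] hσJ hp hσp (algebraMap A _ (e.symm (X 3))) - algebraMap A _ (e.symm (X 3)) =
      cobordantAlgebra.s (e.symm ∘ ![X 0, X 1, X 2] : Fin 3 → A) ![δ + 1, 1, 1] ^ δ * ⟨_, C_mul_T_mem_cobordantAlgebra _ _ ht⟩ := by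
  have hyj : τ (e.symm (X 3)) - e.symm (X 3) = 1 * e.symm t := by rw [A1.act_symm σ e τ hact, h3, map_add]; ring
  have h := sigmaR_sub_eq_of_admissible_shift (e.symm ∘ ![X 0, X 1, X 2] : Fin 3 → A) ![δ + 1, 1, 1] τ hσJ hp hσp δ 1 (n := 0) hyj
    (algebraMap A _ (e.symm (X 3))) ⟨_, C_mul_T_mem_cobordantAlgebra _ _ ht⟩
    (by rw [cobordantAlgebra.coe_algebraMap, Nat.cast_zero, LaurentPolynomial.T_zero, mul_one]) (by rw [Nat.zero_add])
  rw [h, map_one, one_mul]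

include h3 hact in
/-- ★ `t̂ ∈ 𝔞 = (aug σ_R : s^δ)`: on the norm charts the residual lies in `V(u₀′) ∩ V(t̂)`. [OURS · L1 W4.5c · symmetric root, general tail] -/
theorem symT_tail_mem_residual :
    (⟨_, C_mul_T_mem_cobordantAlgebra _ _ ht⟩ : ↥(cobordantAlgebra (e.symm ∘ ![X 0, X 1, X 2] : Fin 3 → A) ![δ + 1, 1, 1])) ∈
      (augmentationIdeal (sigmaR τ (e.symm ∘ ![X 0, X 1, X 2] : Fin 3 → A) ![δ + 1, 1, 1] hσJ hp hσp)).colon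
        (Ideal.span {cobordantAlgebra.s (e.symm ∘ ![X 0, X 1, X 2] : Fin 3 → A) ![δ + 1, 1, 1] ^ δ}) := by
  rw [Ideal.mem_colon_span_singleton, mul_comm, ← symT_sigmaR_algebraMap_three_sub σ δ t h3 e τ hact ht hp hσp hσJ]
  exact sub_mem_augmentationIdeal _ _

end Residual

/-! ## Model level -/

section Model

variable {p : ℕ} (hp : 0 < p) (hσp : ∀ x : A, (⇑τ)^[p] x = x)
  (hσJ : ∀ n : ℕ, ((weightedFiltration (e.symm ∘ ![X 0, X 1, X 2] : Fin 3 → A) ![δ + 1, 1, 1]).ideal n).map (τ : A →+* A) ≤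
    (weightedFiltration (e.symm ∘ ![X 0, X 1, X 2] : Fin 3 → A) ![δ + 1, 1, 1]).ideal n)
  (Ψ : ↥(cobordantAlgebra (e.symm ∘ ![X 0, X 1, X 2] : Fin 3 → A) ![δ + 1, 1, 1]) ≃+* MvPolynomial (Option (Fin 4)) k)
  (hΨa : ∀ a : MvPolynomial (Fin 4) k, Ψ (algebraMap A _ (e.symm a)) = cobordantAlgebra.subst k (![δ + 1, 1, 1, 0] : Fin 4 → ℕ) a)
  (hΨs : Ψ (cobordantAlgebra.s _ _) = X none)

include hΨa hΨs in
/-- ★ **Tail pin**: `x_none^δ · Ψ t̂ = subst t`. -/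
theorem symT_model_tail_pin : X none ^ δ * Ψ ⟨_, C_mul_T_mem_cobordantAlgebra _ _ ht⟩ = cobordantAlgebra.subst k (![δ + 1, 1, 1, 0] : Fin 4 → ℕ) t := by
  have hRw : cobordantAlgebra.s (e.symm ∘ ![X 0, X 1, X 2] : Fin 3 → A) ![δ + 1, 1, 1] ^ δ * ⟨_, C_mul_T_mem_cobordantAlgebra _ _ ht⟩ = algebraMap A _ (e.symm t) := by
    refine Subtype.ext ?_
    rw [MulMemClass.coe_mul, cobordantAlgebra.coe_s_pow, cobordantAlgebra.coe_algebraMap]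
    change LaurentPolynomial.T (-((δ : ℕ) : ℤ)) * (LaurentPolynomial.C (e.symm t) * LaurentPolynomial.T ((δ : ℕ) : ℤ)) = _
    rw [mul_left_comm, ← LaurentPolynomial.T_add, neg_add_cancel, LaurentPolynomial.T_zero, mul_one]
  rw [← hΨa, ← hRw, map_mul, map_pow, hΨs]

include hact h3 hΨa hΨs in
/-- `σ_P x₃ = x₃ + x_none^δ · Ψ t̂`. -/
theorem symT_sigmaP_X_some_three : conj Ψ (sigmaR τ _ _ hσJ hp hσp) (X (some 3)) = X (some 3) + X none ^ δ * Ψ ⟨_, C_mul_T_mem_cobordantAlgebra _ _ ht⟩ := by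
  have hx := congrArg (conj Ψ (sigmaR τ _ _ hσJ hp hσp)) (sym_model_X_three δ e Ψ hΨa)
  rw [← hx, conj_apply_map]
  have h := symT_sigmaR_algebraMap_three_sub σ δ t h3 e τ hact ht hp hσp hσJ
  rw [sub_eq_iff_eq_add] at h
  rw [h, map_add, map_mul, map_pow, sym_model_X_three δ e Ψ hΨa, hΨs, add_comm]

variable {m : ℕ} (mo : Fin m → ℕ) (𝒜 : (Π j : Fin m, ZMod (mo j)) → AddSubgroup A) [GradedRing 𝒜]
  (hf : ∀ i, (e.symm ∘ ![X 0, X 1, X 2] : Fin 3 → A) i ∈ 𝒜 ((fun _ => (0 : Π j : Fin m, ZMod (mo j))) i)) (ht0 : e.symm t ∈ 𝒜 0)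
  {dbar : ℕ} (y : ↥(𝒜 0)) (hy : y ∈ (traceFiltration 𝒜 (e.symm ∘ ![X 0, X 1, X 2] : Fin 3 → A) ![δ + 1, 1, 1]).ideal dbar) (hσy : τ (y : A) = y)

include ht hact h3 hΨa hΨs in
/-- Row (general tail): `τ′ x₃ = x₃ + x_none^δ · T′` for any `T′` with `subst t = x_none^δ · T′`. -/
theorem symT_model_row_three (T' : MvPolynomial (Option (Fin 4)) k) (hT' : cobordantAlgebra.subst k (![δ + 1, 1, 1, 0] : Fin 4 → ℕ) t = X none ^ δ * T') :
    conj (chartRingEquivAway 𝒜 _ _ dbar y hy Ψ) (sigmaChart 𝒜 _ _ dbar y hy τ hσJ hp hσp hσy)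
        (algebraMap (MvPolynomial (Option (Fin 4)) k) (Localization.Away (Ψ (coverElement 𝒜 _ _ dbar y hy))) (X (some 3))) =
      algebraMap (MvPolynomial (Option (Fin 4)) k) (Localization.Away (Ψ (coverElement 𝒜 _ _ dbar y hy))) (X (some 3)) +
        algebraMap (MvPolynomial (Option (Fin 4)) k) (Localization.Away (Ψ (coverElement 𝒜 _ _ dbar y hy))) (X none) ^ δ *
          algebraMap (MvPolynomial (Option (Fin 4)) k) (Localization.Away (Ψ (coverElement 𝒜 _ _ dbar y hy))) T' := by
  have hTT : Ψ ⟨_, C_mul_T_mem_cobordantAlgebra _ _ ht⟩ = T' := by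
    have h := symT_model_tail_pin δ t e ht Ψ hΨa hΨs
    rw [hT'] at h
    exact mul_left_cancel₀ (pow_ne_zero _ (MvPolynomial.X_ne_zero none)) h
  have h := modelSigma_apply_algebraMap mo 𝒜 _ _ dbar y hy τ hσJ hp hσp hσy Ψ (Ψ.symm (X (some 3)))
  rw [Ψ.apply_symm_apply] at h
  rw [h, ← conj_apply, symT_sigmaP_X_some_three σ δ t h3 e τ hact ht hp hσp hσJ Ψ hΨa hΨs, hTT, map_add, map_mul, map_pow]

include ht0 in
/-- `Ψ t̂` has degree `δ • θ`. -/
theorem symT_model_degree_tail :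
    letI := chartNodeGradedRing mo 𝒜 (e.symm ∘ ![X 0, X 1, X 2] : Fin 3 → A) ![δ + 1, 1, 1] hf dbar y hy
    algebraMap (MvPolynomial (Option (Fin 4)) k) (Localization.Away (Ψ (coverElement 𝒜 _ _ dbar y hy))) (Ψ ⟨_, C_mul_T_mem_cobordantAlgebra _ _ ht⟩) ∈
      mapGrading (chartNodeGrading mo 𝒜 (e.symm ∘ ![X 0, X 1, X 2] : Fin 3 → A) ![δ + 1, 1, 1] hf dbar y hy) (chartRingEquivAway 𝒜 _ _ dbar y hy Ψ)
        (δ • consIndexEquiv mo ((1 : ℤ), (0 : Π j : Fin m, ZMod (mo j)))) := by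
  letI := chartNodeGradedRing mo 𝒜 (e.symm ∘ ![X 0, X 1, X 2] : Fin 3 → A) ![δ + 1, 1, 1] hf dbar y hy
  have h := algebraMap_mem_mapGrading_chartNode mo 𝒜 (e.symm ∘ ![X 0, X 1, X 2] : Fin 3 → A) ![δ + 1, 1, 1] hf dbar y hy Ψ
    (mk_mem_reesPiece 𝒜 (e.symm ∘ ![X 0, X 1, X 2] : Fin 3 → A) ![δ + 1, 1, 1] ht0 (C_mul_T_mem_cobordantAlgebra _ _ ht))
  rw [consIndexEquiv_nat_zero mo δ] at h
  exact h

/-! ## Sections -/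

include hf ht0 in
/-- `t̂ⁿ` has bidegree `(δn, 0)`. -/
theorem symT_tail_pow_mem_reesPiece (n : ℕ) :
    (⟨_, C_mul_T_mem_cobordantAlgebra _ _ ht⟩ : ↥(cobordantAlgebra (e.symm ∘ ![X 0, X 1, X 2] : Fin 3 → A) ![δ + 1, 1, 1])) ^ n ∈
      reesPiece 𝒜 (e.symm ∘ ![X 0, X 1, X 2] : Fin 3 → A) ![δ + 1, 1, 1] (((δ * n : ℕ) : ℤ), (0 : Π j : Fin m, ZMod (mo j))) := by
  letI := reesGradedRing 𝒜 (e.symm ∘ ![X 0, X 1, X 2] : Fin 3 → A) ![δ + 1, 1, 1] hf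
  have h := SetLike.pow_mem_graded n (mk_mem_reesPiece 𝒜 (e.symm ∘ ![X 0, X 1, X 2] : Fin 3 → A) ![δ + 1, 1, 1] ht0 (C_mul_T_mem_cobordantAlgebra _ _ ht))
  have e1 : n • (((δ : ℕ) : ℤ), (0 : Π j : Fin m, ZMod (mo j))) = (((δ * n : ℕ) : ℤ), (0 : Π j : Fin m, ZMod (mo j))) := by
    refine Prod.ext ?_ ?_
    · change n • ((δ : ℕ) : ℤ) = ((δ * n : ℕ) : ℤ); rw [nsmul_eq_mul]; push_cast; ring
    · change n • (0 : Π j : Fin m, ZMod (mo j)) = 0; exact smul_zero _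
  rwa [e1] at h

include hf ht0 in
/-- ★ **Residual section of the tail** on the chart of `c = yT^{dbar}` (`dbar = d·((δ+1)δp)`): `t̂^{(δ+1)dp}/c` has degree `0` and lies in `𝔞·R_c` for every
ideal `𝔞 ∋ t̂`. -/
theorem symT_residualSection_one (d : ℕ) (hdbar : dbar = d * ((δ + 1) * δ * p)) (𝔞 : Ideal ↥(cobordantAlgebra (e.symm ∘ ![X 0, X 1, X 2] : Fin 3 → A) ![δ + 1, 1, 1]))
    (h𝔞 : (⟨_, C_mul_T_mem_cobordantAlgebra _ _ ht⟩ : ↥(cobordantAlgebra (e.symm ∘ ![X 0, X 1, X 2] : Fin 3 → A) ![δ + 1, 1, 1])) ∈ 𝔞) (hn : 0 < (δ + 1) * (d * p)) :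
    algebraMap _ (ChartRing 𝒜 (e.symm ∘ ![X 0, X 1, X 2] : Fin 3 → A) ![δ + 1, 1, 1] dbar y hy)
          ((⟨_, C_mul_T_mem_cobordantAlgebra _ _ ht⟩ : ↥(cobordantAlgebra (e.symm ∘ ![X 0, X 1, X 2] : Fin 3 → A) ![δ + 1, 1, 1])) ^ ((δ + 1) * (d * p))) *
        IsLocalization.Away.invSelf (coverElement 𝒜 (e.symm ∘ ![X 0, X 1, X 2] : Fin 3 → A) ![δ + 1, 1, 1] dbar y hy) ∈
        chartNodeGrading mo 𝒜 (e.symm ∘ ![X 0, X 1, X 2] : Fin 3 → A) ![δ + 1, 1, 1] hf dbar y hy 0 ∧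
      algebraMap _ (ChartRing 𝒜 (e.symm ∘ ![X 0, X 1, X 2] : Fin 3 → A) ![δ + 1, 1, 1] dbar y hy)
          ((⟨_, C_mul_T_mem_cobordantAlgebra _ _ ht⟩ : ↥(cobordantAlgebra (e.symm ∘ ![X 0, X 1, X 2] : Fin 3 → A) ![δ + 1, 1, 1])) ^ ((δ + 1) * (d * p))) *
        IsLocalization.Away.invSelf (coverElement 𝒜 (e.symm ∘ ![X 0, X 1, X 2] : Fin 3 → A) ![δ + 1, 1, 1] dbar y hy) ∈
        𝔞.map (algebraMap _ (ChartRing 𝒜 (e.symm ∘ ![X 0, X 1, X 2] : Fin 3 → A) ![δ + 1, 1, 1] dbar y hy)) := by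
  refine ⟨residualSection_mem_chartNodeGrading_zero mo 𝒜 _ _ hf y hy ?_, residualSection_mem_map mo 𝒜 _ _ y hy (Ideal.pow_mem_of_mem 𝔞 h𝔞 _ hn)⟩
  have h := symT_tail_pow_mem_reesPiece δ t e ht mo 𝒜 hf ht0 ((δ + 1) * (d * p))
  have e1 : δ * ((δ + 1) * (d * p)) = dbar := by rw [hdbar]; ring
  rwa [e1] at h

end Model

end Summit.ResolutionOfSingularities.ResolutionOfSingularities.Theorems.WildQuotientResolution.S1.KillCert.Sym

end
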